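import Summits.QuantumFields.QCD.Theses.SmallBetaInfraredSplit
import Literature.MathematicalPhysics.StatisticalMechanics.ComplexSpinFluctuationBound
import Literature.MathematicalPhysics.StatisticalMechanics.ComplexSpinFluctuationFiveSixCertificate

/-!
# Route `SmallBetaInfraredSplit` (sub QCD) — support item `MarginLargeTorus` (S2), PROVED

The printed numerical margin of Salmhofer–Seiler's chiral long-range-order argument on large even
tori: for `1 ≤ N ≤ 4`, `ν ≥ 4` there are `μ > 0` and `L₁` with
`μ ≤ 1/K(N) − 2·S_Λ(ν)/N` and `S_Λ(ν) ≤ 1` for every even `L ≥ L₁`.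

Proof: the tree's bound `fluctS ν < 7/20` for `ν ≥ 4` (`ComplexSpin.fluctS_lt_of_four_le`, from the
certificates `S(4) ≤ 0.3471`, `S(5) ≤ 0.2542`, `S(6) ≤ 0.2081` and the decreasing envelope for
`ν ≥ 7`), the Riemann-sum convergence `S_Λ(ν) → S(ν)` on even tori
(`ComplexSpin.latticeS_tendsto_fluctS`) with `ε := (7/20 − S(ν))/2`, and the one-link constants
`K(1..4) = 1, 2, 10/3, 83/15` (`ComplexSpin.sdK_uN_one … four`): `(7/10)/N < 1/K(N)` for `N ≤ 4`
(at `N = 4`: `0.175 < 15/83 ≈ 0.1807`).  Witness `μ := 1/K(N) − (7/20 + S(ν))/N`.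

This is glue of LINE 6 (ideator `ym-idea-2` g4) onto the LADDER-YM rung Q1 leaf
`SalmhoferSeilerSmallBeta` (label RECORD, QCD side).  Nothing about a mass gap, a continuum limit,
or any summit is proved here.
[cite: SalmhoferSeiler1991, Prop. 4.2 (4), (4.43); SalmhoferSeiler1992Erratum]
-/

set_option autoImplicit false

namespace Summit.QuantumFields.QCD.Theorems.SmallBetaInfraredSplit

open Literature.MathematicalPhysics.StatisticalMechanics.ComplexSpin

/-- The one-link margin inequality `(7/10)/N < 1/K(N)` for `N = 1, 2, 3, 4`
(`K = 1, 2, 10/3, 83/15`). [cite: SalmhoferSeiler1991, (4.43) and Table after (4.38)] -/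
theorem seven_tenths_div_lt_inv_sdK {N : ℕ} (hN1 : 1 ≤ N) (hN4 : N ≤ 4) :
    (7 : ℝ) / 10 / N < 1 / sdK N (uNLogCoeff N) := by
  interval_cases N
  · rw [sdK_uN_one]; norm_num
  · rw [sdK_uN_two]; norm_num
  · rw [sdK_uN_three]; norm_num
  · rw [sdK_uN_four]; norm_num

/-- The route's support item `MarginLargeTorus` BY NAME: for `1 ≤ N ≤ 4`, `ν ≥ 4` there are
`μ > 0` and `L₁` with `μ ≤ 1/K(N) − 2·latticeS ν L/N` and `latticeS ν L ≤ 1` for all even `L ≥ L₁`.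
[cite: SalmhoferSeiler1991, Prop. 4.2 (4) and (4.43)] -/
theorem marginLargeTorus_proof :
    Summit.QuantumFields.QCD.Theses.SmallBetaInfraredSplit.MarginLargeTorus := by
  intro N ν hN1 hN4 hν
  have hν3 : 3 ≤ ν := le_trans (by norm_num) hν
  have hs_lt : fluctS ν < 7 / 20 := fluctS_lt_of_four_le hν
  have hNpos : (0 : ℝ) < N := Nat.cast_pos.mpr (by omega)
  obtain ⟨L₁, hL₁⟩ :=
    latticeS_tendsto_fluctS (ν := ν) hν3 (ε := (7 / 20 - fluctS ν) / 2) (by linarith)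
  have hK := seven_tenths_div_lt_inv_sdK hN1 hN4
  refine ⟨1 / sdK N (uNLogCoeff N) - (7 / 20 + fluctS ν) / N, ?_, L₁, ?_⟩
  · have hlt : (7 / 20 + fluctS ν) / (N : ℝ) < 7 / 10 / N := by
      apply div_lt_div_of_pos_right _ hNpos
      linarith
    linarith
  · intro L _ hE hL
    have h := hL₁ L hE hL
    have hle : latticeS ν L ≤ (7 / 20 + fluctS ν) / 2 := by
      have h2 := (abs_le.mp h).2
      linarith
    refine ⟨?_, ?_⟩
    · have hdiv : 2 * latticeS ν L / (N : ℝ) ≤ (7 / 20 + fluctS ν) / N := by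
        apply div_le_div_of_nonneg_right _ hNpos.le
        linarith
      linarith
    · linarith

end Summit.QuantumFields.QCD.Theorems.SmallBetaInfraredSplit
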